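import Summits.BirchSwinnertonDyer.Rank1Residual.X11a.BaseChangeRoute
import Summits.BirchSwinnertonDyer.Rank1Residual.Partition.CellOf
import Literature.NumberTheory.EllipticCurves.Skinner2016.MultiplicativeMainConjecture
import HarnessLib

/-!
# Class X11a (N7): the "(ram) acquired over a quadratic twist / base change" transport candidate
# (obsanat `T-BCRAM`, atom `ram_over_quadratic_basechange`) TYPED — and shown to descend to
# exactly Mazur's main conjecture at the pair (cell `b2b-bsdres`, lane CLASS-CLOSURE, `cc-typer-3`)

HONEST FRAMING (run/shared/lean/b2b/bsd-rank1-residual/, verbatim in every file): the goal of the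
cell is to DELETE the COMBINATION-SHAPED residual classes of the Birch–Swinnerton-Dyer formula for
ALL analytic-rank `≤ 1` elliptic curves over `ℚ` — assembled STRICTLY from published theorems — so
that the rank-`≤ 1` remainder becomes exactly the CONSTRUCTION-SHAPED classes, which are TYPED
(missing-input `Prop`s), NOT attempted. This is not "finishing BSD". Research lane CLASS-CLOSURE
(CLASS-CLOSURE-PLAN §3.13, class N7 = X11a: `p ‖ N`, `r_an = 0`, `E[p]` irreducible, NO (ram)
prime; experiment type E3 = TRANSPORT); NO CLAIM BEYOND STATED CLASSES. One census predicate, ONE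
typed OPEN input (an `@[conjecture]`-tagged `Prop`, nothing asserted, never a Literature fact);
theorems only otherwise; every published input is an explicit NAMED-FACT hypothesis already in the
tree; nothing is booked by this file and no label changes (class lead x11a lineage / referee).

WHAT (typer deliverable T2/T4 for N7, OWNERS.md row `cc-typer-3`; RESIDUAL-MAP §C rmap-1 g7 input;
instrument `obsanat` 0.2.0 row `T-BCRAM — TRANSPORT CANDIDATE (not in print as such) … (to type)`,
`class-closure/N7/SUBPARTITION.md`: 251 of 727 cells `HOLDS-modulo-cert`). The candidate: an X11a
pair `(E, p)` has no multiplicative prime `ℓ ≠ p` with `p ∤ v_ℓ(Δ)`, so Skinner–Urban 3.6.11 /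
Skinner 2016 Thm. C / Thm. A do not apply to `E`; but if `E` has an ADDITIVE, potentially
multiplicative prime `q` with `p ∤ v_q(j)`, then the quadratic twist `E^{(d)}` by the local
twisting character (`p ∤ d`) IS multiplicative at `q` with `p ∤ v_q(Δ(E^{(d)})) = -v_q(j)`: the twist —
equivalently `E` over `F = ℚ(√d)` at `w ∣ q` — HAS a (ram) prime, and is still multiplicative at `p`
with the same (surjective) `ρ̄`. Over `F` a Skinner–Urban/Wan-type main-conjecture LOWER BOUND with
(ram) at `w` is then the natural source; descended to `ℚ` (`p` odd:
`X(E/F_∞) ∼ X(E/ℚ_∞) ⊕ X(E^{(d)}/ℚ_∞)`, `L_p(E/F) ≐ L_p(E) · L_p(E^{(d)})`) it is the TWO-factor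
integral display `RamTwistLowerBoundAt W p W₁` typed below (same currency as the x11a gen-23
FOUR-factor Burungale–Castella–Skinner display `X11a.BaseChangeLowerBoundAt`, whose fields are
UNRAMIFIED at every `ℓ ∣ N` — the (ram)-acquisition idea is precisely what that route does NOT use,
see its module docstring; this file types the complementary candidate).

RESULT (the typed finding, kernel-checked): **descended to `ℚ`, the T-BCRAM input is EQUIVALENT
to Mazur's main conjecture at `(E, p)` itself** (`ramTwistLowerBoundAt_iff_mazurMainConjectureAt`):
Skinner 2016 Thm. A gives the main conjecture for the twist `E^{(d)}` OUTRIGHT (it has (ram), `E[p]`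
irreducible, `p ≥ 3` multiplicative), Kato–Wuthrich (A32) gives the upper bound for `E`, and in the
domain `Λ = ℤ_p⟦T⟧` a product display with one factor an equality is the other factor's lower bound
(`isUnit_of_prod_mem_span₂`). So T-BCRAM is NOT an independent certificate: over `ℚ` its "cert" is
the X11a END-STATE input (`X2.MazurMainConjectureAt W p` ⟺ `X11a.MuAnZeroAt` given the residual
transfer, x11a gens 20–22); what the candidate contributes is only a candidate SOURCE upstairs — an
INTEGRAL Hilbert-modular main-conjecture lower bound for `E/ℚ(√d)` with (ram) at `w ∣ q` (Wan,
Forum Math. Sigma 3 (2015) e18, Thms. 3–4: rational version (`Λ[1/p]`) under his hypotheses; the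
integral version at `p ‖ N` is the located gap `NOGO-INTEGRAL-ANCHOR` of x11a gen 21) plus the
descent bookkeeping. The
obsanat verdict `HOLDS-modulo-cert:T-BCRAM` on 251 cells is therefore to be read as "same missing
input as T-X11A, second candidate source", not as a second route (reported to cc-eng-1 / x11a /
cc-lead; EVIDENCE bookkeeping only, no label change).

CONTENTS. `RamOverQuadraticTwistAt W p` (census atom: some quadratic twist with `p ∤ d` has a
globally minimal model with a (ram) prime for `p`; the obsanat bit "additive pot-mult `q` with
`p ∤ v_q(j)`" implies it by Tate's algorithm for twists — Silverman AEC VII.5.4/C.16, Rohrlich 1993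
§2 — NOT proved here, flagged); `RamTwistLowerBoundAt W p W₁` (typed OPEN input);
`skinner_trivialZeroFactor` (Skinner Thm. A for the twist in the uniform shape `ι(T^{e₁} g₁ w₁) = ϖ₁ L₁`);
`isUnit_of_prod_mem_span₂`; `mazurMainConjectureAt_of_ramTwistLowerBound`;
`ramTwistLowerBoundAt_of_mazurMainConjectureAt`; `ramTwistLowerBoundAt_iff_mazurMainConjectureAt`;
`bsdp_of_ramTwistLowerBound` (ClassX11a, `p ≥ 5`, `ρ̄` onto: `BSD(E,p)` ⇐ the typed input + A32 +
Skinner Thm. A + SW13 Thm. 6.1 ×2 + Greenberg–Stevens + GZK + modularity).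

References: [Skinner2016PacificMC] Thm. A, §3.2–3.3; [SkinnerUrban2014] Thm. 3.6.11 hypotheses;
[Wan2015HilbertIMC] X. Wan, The Iwasawa main conjecture for Hilbert modular forms, Forum Math.
Sigma 3 (2015) e18, Thms. 3–4 (shape/source only; nothing asserted; conditional status of Thm. 4:
Burungale–Castella–Skinner 2025 Rem. 1.1.3 (ii)); [Wuthrich2014] Thm. 3, Cor. 19;
[BurungaleCastellaSkinner2025] §5 (contrast); HOME/class-closure/N7/SUBPARTITION.md (obsanat T-BCRAM);
HOME/RESIDUAL-MAP.md §C (rmap-1 g7); HOME/b2b-bsdres-x11a/g21/NOGO-INTEGRAL-ANCHOR.md.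
-/

set_option autoImplicit false

noncomputable section

open scoped Classical MatrixGroups ModularForm

open CongruenceSubgroup WeierstrassCurve Literature.NumberTheory.EllipticCurves
  Literature.NumberTheory.EllipticCurves.ModularForms
  Literature.NumberTheory.EllipticCurves.Rank1Residual
  Literature.NumberTheory.EllipticCurves.Rank1Residual.Typed
  Literature.NumberTheory.EllipticCurves.Wuthrich2014
  Literature.NumberTheory.EllipticCurves.SteinWuthrich2013
  Literature.NumberTheory.EllipticCurves.Skinner2016

namespace Summit.BirchSwinnertonDyer.Rank1Residual.X11a

section Typed

variable (W : WeierstrassCurve ℚ) [W.IsElliptic] [W.IsGloballyMinimal] (p : ℕ) [Fact p.Prime]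

/-- **Census atom `ram_over_quadratic_basechange` (obsanat T-BCRAM), typed**: some quadratic twist
`E^{(d)}`, `d ≠ 0`, `p ∤ d` (so the twist is still multiplicative at `p` with the same `ρ̄`), has a
globally minimal model `W₁` with a (ram) prime for `p` (`Ram W₁ p`: a multiplicative `ℓ ≠ p` with
`p ∤ v_ℓ(Δ_min(W₁))`). The instrument computes the sufficient condition "an additive, potentially
multiplicative prime `q ≠ p` of `E` with `p ∤ v_q(j(E))`" (twist by the local character at `q`:
`E^{(d)}` multiplicative at `q`, `v_q(Δ_min) = -v_q(j)`); that implication is Tate's algorithm for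
twists and is NOT proved in this file. Decidable from `(a₁,…,a₆, p)`. Nothing asserted.
[cite: SilvermanAEC2009, VII.5.4 and C.16 (potentially multiplicative ⟺ `v(j) < 0`)] [folklore] -/
def RamOverQuadraticTwistAt : Prop :=
  ∃ (d : ℤ) (W₁ : WeierstrassCurve ℚ) (_ : W₁.IsElliptic) (_ : W₁.IsGloballyMinimal),
    d ≠ 0 ∧ ¬ (p : ℤ) ∣ d ∧ (∃ C : VariableChange ℚ, C • W₁ = W.quadraticTwist (d : ℚ)) ∧ Ram W₁ p

/-- **Typed OPEN input of the T-BCRAM transport candidate (nothing asserted; never a fact): the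
TWO-factor integral main-conjecture display for `(E, E^{(d)})` at a multiplicative `p`,
Néron-normalised** — for the cyclotomic data `(κ, γ)`, all newforms `f, f₁` of the globally minimal
`W, W₁` (`W₁` a model of the twist), all dual Selmer data `D, D₁`, all `ϖ, ϖ₁ ∈ ℚ` with
`ϖ · Ω = Ω⁺_f`, `ϖ₁ · Ω₁ = Ω⁺_{f₁}`, and THE multiplicative Mazur–Tate–Teitelbaum functions `L, L₁`:
some `G ∈ Λ` has `ι G = (ϖ ϖ₁) · L L₁` and `(T^{e+e₁}) · ch X · ch X₁ ⊆ (G)`. This is the shape a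
Skinner–Urban/Wan-type lower bound for `E` over `F = ℚ(√d)` (where (ram) holds at `w ∣ q`) takes
after descent to `ℚ` for odd `p`; STATUS: not in print at `p ‖ N` integrally (Wan 2015, Forum
Math. Sigma 3, e18: Hilbert modular forms over totally real `F`, one divisibility in `Λ[1/p]` under
(irr), (dist) and a (ram)-type hypothesis; integral version = x11a gen 21 `NOGO-INTEGRAL-ANCHOR`);
typed so that the census verdict
`HOLDS-modulo-cert:T-BCRAM` has a kernel name. See `ramTwistLowerBoundAt_iff_mazurMainConjectureAt`:
over `ℚ` this input is EQUIVALENT to `X2.MazurMainConjectureAt W p`.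
[cite: Wan2015HilbertIMC, main theorem (shape/source only; nothing asserted)]
[cite: Skinner2016PacificMC, §3.2–3.3 (shape only)] -/
@[conjecture]
def RamTwistLowerBoundAt (W₁ : WeierstrassCurve ℚ) [W₁.IsElliptic] [W₁.IsGloballyMinimal] : Prop :=
  ∀ (κ : ZpExtension ℚ p) (γ : Field.absoluteGaloisGroup ℚ),
      κ.IsCyclotomic → κ.IsTopGenerator γ → IsCyclotomicVariable p γ →
    ∀ {N : ℕ} [NeZero N] (f : CuspForm (Gamma0 N) 2), IsNewformOf W f →
    ∀ {N₁ : ℕ} [NeZero N₁] (f₁ : CuspForm (Gamma0 N₁) 2), IsNewformOf W₁ f₁ →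
    ∀ (D : W.SelmerDualData κ γ) (D₁ : W₁.SelmerDualData κ γ) (ϖ ϖ₁ : ℚ),
      (ϖ : ℝ) * W.realPeriodRat = plusPeriod f → (ϖ₁ : ℝ) * W₁.realPeriodRat = plusPeriod f₁ →
    ∀ (L L₁ : PowerSeries ℚ_[p]),
      IsTheMultPAdicLFunctionOf W f p L → IsTheMultPAdicLFunctionOf W₁ f₁ p L₁ →
    ∃ G : IwasawaAlgebra p,
      iwasawaToPowerSeries p G = PowerSeries.C (((ϖ * ϖ₁ : ℚ)) : ℚ_[p]) * (L * L₁) ∧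
        Ideal.span {trivialZeroFactor W p * trivialZeroFactor W₁ p} * (D.charIdeal * D₁.charIdeal) ≤
          Ideal.span {G}

end Typed

/-- **Pure algebra, two factors** (cf. `isUnit_of_prod_mem_span`): in a domain, `t₀t₁ ≠ 0`,
`c₀c₁ ≠ 0`, `t₀t₁ · c₀c₁ ∈ (t₀h₀c₀ · t₁h₁c₁)` force `h₀`, `h₁` to be units. [folklore] -/
theorem isUnit_of_prod_mem_span₂ {R : Type*} [CommRing R] [IsDomain R] {t₀ t₁ c₀ c₁ h₀ h₁ : R}
    (ht : t₀ * t₁ ≠ 0) (hc : c₀ * c₁ ≠ 0)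
    (hmem : t₀ * t₁ * (c₀ * c₁) ∈ Ideal.span {t₀ * (h₀ * c₀) * (t₁ * (h₁ * c₁))}) :
    IsUnit h₀ ∧ IsUnit h₁ := by
  obtain ⟨a, ha⟩ := Ideal.mem_span_singleton'.mp hmem
  have hne : t₀ * t₁ * (c₀ * c₁) ≠ 0 := mul_ne_zero ht hc
  have key : a * (h₀ * h₁) * (t₀ * t₁ * (c₀ * c₁)) = 1 * (t₀ * t₁ * (c₀ * c₁)) := by
    linear_combination ha
  have h1 : a * (h₀ * h₁) = 1 := mul_right_cancel₀ hne key
  have hu : IsUnit (h₀ * h₁) := IsUnit.of_mul_eq_one a (by rw [mul_comm]; exact h1)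
  exact IsUnit.mul_iff.mp hu

/-- **Skinner 2016 Thm. A for a curve WITH (ram), in the uniform shape** `ι(T^{e} · g · w) = ϖ · L`
for THE multiplicative function, `ch X = (g)`, `w ∈ Λ^×` (`T^e` = `trivialZeroFactor`): the two
split-type clauses of the named fact merged. [cite: Skinner2016PacificMC, Thm. A and §3.2–3.3] -/
theorem skinner_trivialZeroFactor (hA : thmA_charIdeal_multiplicative)
    (W₁ : WeierstrassCurve ℚ) [W₁.IsElliptic] [W₁.IsGloballyMinimal] (p : ℕ) [Fact p.Prime]
    {κ : ZpExtension ℚ p} {γ : Field.absoluteGaloisGroup ℚ} {N₁ : ℕ} [NeZero N₁]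
    {f₁ : CuspForm (Gamma0 N₁) 2} (hp : 3 ≤ p) (hmult : W₁.HasMultiplicativeReductionAtPrime p)
    (hirr : Irr W₁ p) (hram : Ram W₁ p) (hκ : κ.IsCyclotomic) (hγ : κ.IsTopGenerator γ)
    (hγ' : IsCyclotomicVariable p γ) (hf : IsNewformOf W₁ f₁) (D₁ : W₁.SelmerDualData κ γ) (ϖ₁ : ℚ)
    (hϖ0 : ϖ₁ ≠ 0) (hϖ : (ϖ₁ : ℝ) * W₁.realPeriodRat = plusPeriod f₁) (L₁ : PowerSeries ℚ_[p])
    (hL : IsTheMultPAdicLFunctionOf W₁ f₁ p L₁) :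
    ∃ g : IwasawaAlgebra p, D₁.charIdeal = Ideal.span {g} ∧ ∃ w : (IwasawaAlgebra p)ˣ,
      iwasawaToPowerSeries p (trivialZeroFactor W₁ p * g * (w : IwasawaAlgebra p)) =
        PowerSeries.C ((ϖ₁ : ℚ) : ℚ_[p]) * L₁ := by
  obtain ⟨-, g, hg, hS, hN⟩ := hA W₁ p hp hmult hirr hram hκ hγ hγ' hf D₁ ϖ₁ hϖ0 hϖ
  refine ⟨g, hg, ?_⟩
  by_cases hs : W₁.HasSplitMultiplicativeReductionAtPrime p
  · obtain ⟨w, hw⟩ := hS hs L₁ (hL.1 hs)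
    exact ⟨w, by rw [trivialZeroFactor_of_split W₁ p hs]; exact hw⟩
  · obtain ⟨w, hw⟩ := hN hs L₁ (hL.2 hs)
    exact ⟨w, by rw [trivialZeroFactor_of_not_split W₁ p hs, one_mul]; exact hw⟩

section Main

variable (W : WeierstrassCurve ℚ) [W.IsElliptic] [W.IsGloballyMinimal] (p : ℕ) [Fact p.Prime]

/-- **Descending the T-BCRAM input: Mazur's main conjecture at `(E, p)` from the two-factor display,
Skinner Thm. A for the twist, and Kato–Wuthrich for `E`.** Hypotheses: the PUBLISHED named facts
A32 (`hKato`) and Skinner 2016 Thm. A (`hA`), modularity as `nonempty_modularParametrizationData`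
(`hpar`: newform and `ϖ₁ > 0` for the twist); `p ≥ 5`, `E` multiplicative at `p`, `ρ̄_{E,p}` onto
(so onto for the twist by twist invariance, hence irreducible, and onto at every level `p^n` by
Serre for A32); the twist datum (`d ≠ 0`, `p ∤ d`, `W₁` a globally minimal model of `E^{(d)}` with
`Ram W₁ p`); the typed OPEN input. Proof: Skinner for `W₁` gives `ch X₁ = (g₁)`,
`ι(T^{e₁} g₁ w₁) = ϖ₁ L₁`; A32 for `W` gives `k₀ = h₀ c₀ ∈ ch X = (c₀)` with `ι(T^e k₀) = ϖ L`;
injectivity of `ι` makes the display's `G` equal `T^e h₀ c₀ · T^{e₁} w₁ g₁`, and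
`T^{e+e₁} c₀ g₁ ∈ (G)` forces `h₀` to be a unit (`isUnit_of_prod_mem_span₂`).
[cite: Skinner2016PacificMC, Thm. A] [cite: Wuthrich2014, Thm. 3 and Cor. 19 (pp. 383, 398–399)]
[cite: SerreAbelianLadic1968, Ch. IV §3.4] -/
theorem mazurMainConjectureAt_of_ramTwistLowerBound
    (hKato : kato_charIdeal_dvd_multiplicative_of_surjective) (hA : thmA_charIdeal_multiplicative)
    (hpar : nonempty_modularParametrizationData)
    (hp : 5 ≤ p) (hmult : W.HasMultiplicativeReductionAtPrime p) (hsurj : Surj W p)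
    {d : ℤ} (hd0 : d ≠ 0) (hpd : ¬ (p : ℤ) ∣ d)
    (W₁ : WeierstrassCurve ℚ) [W₁.IsElliptic] [W₁.IsGloballyMinimal]
    (hC₁ : ∃ C : VariableChange ℚ, C • W₁ = W.quadraticTwist (d : ℚ)) (hram₁ : Ram W₁ p)
    (hBC : RamTwistLowerBoundAt W p W₁) : X2.MazurMainConjectureAt W p := by
  intro κ γ hκ hγ hγ' N _ f hf D ϖ hϖ
  have hp2 : p ≠ 2 := by omega
  have hd0' : (d : ℚ) ≠ 0 := by exact_mod_cast hd0
  obtain ⟨C₁, hC₁⟩ := hC₁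
  have hm₁ : W₁.HasMultiplicativeReductionAtPrime p :=
    X2.hasMultiplicativeReductionAtPrime_of_smul_eq_quadraticTwist W W₁ hC₁ p hp2 hpd hmult
  have hsurj₁ : Surj W₁ p :=
    (Additive.surj_iff_of_model_twist W p hd0' ⟨C₁⁻¹, by rw [← hC₁, inv_smul_smul]⟩).mpr hsurj
  have hirr₁ : Irr W₁ p := irr_of_surj W₁ p hsurj₁
  have hs₀ : ∀ n : ℕ, W.HasSurjectiveModNGaloisRep (p ^ n : ℕ) :=
    kato_charIdeal_dvd_multiplicative_of_surjective.surjective_pow_of_five_le W p hp hsurj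
  haveI : NeZero (W₁.conductorNorm ℤ) := ⟨(W₁.conductorNorm_pos_holds).ne'⟩
  obtain ⟨Dm₁⟩ := hpar W₁
  obtain ⟨ϖ₁, hϖ₁pos, hϖ₁, -⟩ := Dm₁.exists_rat_mul_realPeriodRat_eq_plusPeriod
  set D₁ : W₁.SelmerDualData κ γ := W₁.selmerDualData κ hγ with hD₁
  obtain ⟨L₁, hL₁⟩ := exists_isTheMultPAdicLFunctionOf W₁ Dm₁.f p Dm₁.isNewformOf hm₁
  obtain ⟨g₁, hg₁, w₁, hι₁⟩ := skinner_trivialZeroFactor hA W₁ p (by omega) hm₁ hirr₁ hram₁ hκ hγ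
    hγ' Dm₁.isNewformOf D₁ ϖ₁ hϖ₁pos.ne' hϖ₁ L₁ hL₁
  obtain ⟨c₀, hc₀, hc₀0⟩ := exists_charIdeal_eq_span_singleton p D
  have hg₁0 : g₁ ≠ 0 := by
    obtain ⟨c₁, hc₁, hc₁0⟩ := exists_charIdeal_eq_span_singleton p D₁
    intro h0
    have hbot : Ideal.span {c₁} = ⊥ := by rw [← hc₁, hg₁, h0, Ideal.span_singleton_eq_bot]
    exact hc₁0 (Ideal.span_singleton_eq_bot.mp hbot)
  -- the core: for THE function `L` of `W` and its Kato element, `h₀` is a unit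
  have core : ∀ (L : PowerSeries ℚ_[p]), IsTheMultPAdicLFunctionOf W f p L →
      ∃ w : (IwasawaAlgebra p)ˣ,
        iwasawaToPowerSeries p (trivialZeroFactor W p * c₀ * (w : IwasawaAlgebra p)) =
          PowerSeries.C ((ϖ : ℚ) : ℚ_[p]) * L := by
    intro L hL
    obtain ⟨-, k₀, hk₀, hι₀⟩ := kato_trivialZeroFactor hKato W p hp2 hmult hs₀ hκ hγ hγ' hf D ϖ hϖ L hL
    rw [hc₀] at hk₀
    obtain ⟨h₀, rfl⟩ := Ideal.mem_span_singleton'.mp hk₀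
    obtain ⟨G, hιG, hG⟩ := hBC κ γ hκ hγ hγ' f hf Dm₁.f Dm₁.isNewformOf D D₁ ϖ ϖ₁ hϖ hϖ₁ L L₁ hL hL₁
    set t₀ := trivialZeroFactor W p with ht₀
    set t₁ := trivialZeroFactor W₁ p with ht₁
    have hGeq : G = t₀ * (h₀ * c₀) * (t₁ * ((w₁ : IwasawaAlgebra p) * g₁)) := by
      apply iwasawaToPowerSeries_injective p
      have e₁ : iwasawaToPowerSeries p (t₁ * ((w₁ : IwasawaAlgebra p) * g₁)) =
          PowerSeries.C ((ϖ₁ : ℚ) : ℚ_[p]) * L₁ := by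
        rw [← hι₁]; congr 1; ring
      rw [hιG, map_mul, hι₀, e₁]
      push_cast
      simp only [map_mul]
      ring
    have hmem : t₀ * t₁ * (c₀ * g₁) ∈
        Ideal.span {t₀ * (h₀ * c₀) * (t₁ * ((w₁ : IwasawaAlgebra p) * g₁))} := by
      rw [← hGeq]
      refine hG (Ideal.mul_mem_mul (Ideal.mem_span_singleton_self _) ?_)
      refine Ideal.mul_mem_mul ?_ ?_
      · rw [hc₀]; exact Ideal.mem_span_singleton_self _
      · rw [hg₁]; exact Ideal.mem_span_singleton_self _
    have ht : t₀ * t₁ ≠ 0 :=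
      mul_ne_zero (trivialZeroFactor_ne_zero W p) (trivialZeroFactor_ne_zero W₁ p)
    obtain ⟨hu₀, -⟩ := isUnit_of_prod_mem_span₂ ht (mul_ne_zero hc₀0 hg₁0) hmem
    refine ⟨hu₀.unit, ?_⟩
    rw [IsUnit.unit_spec, ← hι₀]
    congr 1
    ring
  obtain ⟨hX, -⟩ := hKato W p hp2 hmult hs₀ hκ hγ hγ' hf D ϖ hϖ
  refine ⟨hX, c₀, hc₀, fun hsplit L hL => ?_, fun hns L hL => ?_⟩
  · obtain ⟨w, hw⟩ := core L ⟨fun _ => hL, fun h => (h hsplit).elim⟩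
    exact ⟨w, by rw [← hw, trivialZeroFactor_of_split W p hsplit]⟩
  · obtain ⟨w, hw⟩ := core L ⟨fun h => (hns h).elim, fun _ => hL⟩
    exact ⟨w, by rw [← hw, trivialZeroFactor_of_not_split W p hns, one_mul]⟩

/-- **Conversely, Mazur's main conjecture at `(E, p)` and Skinner Thm. A for the twist GIVE the
two-factor display** (with `G = T^e c₀ w₀ · T^{e₁} g₁ w₁`, an equality of ideals in fact): the
T-BCRAM input carries nothing over `ℚ` beyond `X2.MazurMainConjectureAt W p`. Hypotheses as in
`mazurMainConjectureAt_of_ramTwistLowerBound` minus Kato and surjectivity, plus `Irr W₁ p`.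
[cite: Skinner2016PacificMC, Thm. A] -/
theorem ramTwistLowerBoundAt_of_mazurMainConjectureAt (hA : thmA_charIdeal_multiplicative)
    (hp : 3 ≤ p) (hmult : W.HasMultiplicativeReductionAtPrime p) {d : ℤ} (hpd : ¬ (p : ℤ) ∣ d)
    (W₁ : WeierstrassCurve ℚ) [W₁.IsElliptic] [W₁.IsGloballyMinimal]
    (hC₁ : ∃ C : VariableChange ℚ, C • W₁ = W.quadraticTwist (d : ℚ)) (hirr₁ : Irr W₁ p)
    (hram₁ : Ram W₁ p) (hMC : X2.MazurMainConjectureAt W p) : RamTwistLowerBoundAt W p W₁ := by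
  intro κ γ hκ hγ hγ' N _ f hf N₁ _ f₁ hf₁ D D₁ ϖ ϖ₁ hϖ hϖ₁ L L₁ hL hL₁
  have hp2 : p ≠ 2 := by omega
  obtain ⟨C₁, hC₁⟩ := hC₁
  have hm₁ : W₁.HasMultiplicativeReductionAtPrime p :=
    X2.hasMultiplicativeReductionAtPrime_of_smul_eq_quadraticTwist W W₁ hC₁ p hp2 hpd hmult
  -- Mazur for `W` in the uniform shape
  obtain ⟨-, c₀, hc₀, hS, hN⟩ := hMC κ γ hκ hγ hγ' f hf D ϖ hϖ
  have h₀ : ∃ w : (IwasawaAlgebra p)ˣ,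
      iwasawaToPowerSeries p (trivialZeroFactor W p * c₀ * (w : IwasawaAlgebra p)) =
        PowerSeries.C ((ϖ : ℚ) : ℚ_[p]) * L := by
    by_cases hs : W.HasSplitMultiplicativeReductionAtPrime p
    · obtain ⟨w, hw⟩ := hS hs L (hL.1 hs)
      exact ⟨w, by rw [trivialZeroFactor_of_split W p hs]; exact hw⟩
    · obtain ⟨w, hw⟩ := hN hs L (hL.2 hs)
      exact ⟨w, by rw [trivialZeroFactor_of_not_split W p hs, one_mul]; exact hw⟩
  obtain ⟨w₀, hι₀⟩ := h₀
  -- Skinner for `W₁` needs `ϖ₁ ≠ 0`, which holds as `Ω⁺_{f₁} ≠ 0` (`IsNewform0.plusPeriod_pos_holds`)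
  have hϖ₁0 : ϖ₁ ≠ 0 := by
    intro h
    have hpos : 0 < plusPeriod f₁ := IsNewform0.plusPeriod_pos_holds hf₁.1 hf₁.coeffField_eq_bot
    rw [h, Rat.cast_zero, zero_mul] at hϖ₁
    exact hpos.ne' hϖ₁.symm
  obtain ⟨g₁, hg₁, w₁, hι₁⟩ := skinner_trivialZeroFactor hA W₁ p hp hm₁ hirr₁ hram₁ hκ hγ hγ' hf₁ D₁
    ϖ₁ hϖ₁0 hϖ₁ L₁ hL₁
  refine ⟨trivialZeroFactor W p * c₀ * (w₀ : IwasawaAlgebra p) *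
      (trivialZeroFactor W₁ p * g₁ * (w₁ : IwasawaAlgebra p)), ?_, ?_⟩
  · rw [map_mul, hι₀, hι₁]
    push_cast
    simp only [map_mul]
    ring
  · rw [hc₀, hg₁, Ideal.span_singleton_mul_span_singleton, Ideal.span_singleton_mul_span_singleton,
      Ideal.span_singleton_le_span_singleton]
    refine ⟨((w₀⁻¹ * w₁⁻¹ : (IwasawaAlgebra p)ˣ) : IwasawaAlgebra p), ?_⟩
    have e : (w₀ : IwasawaAlgebra p) * (w₁ : IwasawaAlgebra p) *
        (((w₀⁻¹ * w₁⁻¹ : (IwasawaAlgebra p)ˣ) : IwasawaAlgebra p)) = 1 := by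
      rw [Units.val_mul]
      calc (w₀ : IwasawaAlgebra p) * (w₁ : IwasawaAlgebra p) *
            (((w₀⁻¹ : (IwasawaAlgebra p)ˣ) : IwasawaAlgebra p) * ((w₁⁻¹ : (IwasawaAlgebra p)ˣ) : _))
          = ((w₀ : IwasawaAlgebra p) * ((w₀⁻¹ : (IwasawaAlgebra p)ˣ) : IwasawaAlgebra p)) *
              ((w₁ : IwasawaAlgebra p) * ((w₁⁻¹ : (IwasawaAlgebra p)ˣ) : IwasawaAlgebra p)) := by ring
        _ = 1 := by rw [Units.mul_inv, Units.mul_inv, one_mul]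
    linear_combination (-(trivialZeroFactor W p * trivialZeroFactor W₁ p * (c₀ * g₁))) * e

/-- **The typed finding: on the T-BCRAM locus the descended input IS Mazur's main conjecture at the
pair.** For `p ≥ 5` multiplicative, `ρ̄_{E,p}` onto, a twist `W₁` of `E` by `d` (`p ∤ d`) with a
(ram) prime: `RamTwistLowerBoundAt W p W₁ ↔ X2.MazurMainConjectureAt W p`, granted A32 (`hKato`),
Skinner Thm. A (`hA`) and modularity (`hpar`). Consequence for the census: obsanat's
`HOLDS-modulo-cert:T-BCRAM` names the SAME missing input as T-X11A (a second candidate SOURCE —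
an integral Hilbert-modular lower bound over `ℚ(√d)` — not a second route).
[cite: Skinner2016PacificMC, Thm. A] [cite: Wuthrich2014, Thm. 3 and Cor. 19] -/
theorem ramTwistLowerBoundAt_iff_mazurMainConjectureAt
    (hKato : kato_charIdeal_dvd_multiplicative_of_surjective) (hA : thmA_charIdeal_multiplicative)
    (hpar : nonempty_modularParametrizationData)
    (hp : 5 ≤ p) (hmult : W.HasMultiplicativeReductionAtPrime p) (hsurj : Surj W p)
    {d : ℤ} (hd0 : d ≠ 0) (hpd : ¬ (p : ℤ) ∣ d)
    (W₁ : WeierstrassCurve ℚ) [W₁.IsElliptic] [W₁.IsGloballyMinimal]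
    (hC₁ : ∃ C : VariableChange ℚ, C • W₁ = W.quadraticTwist (d : ℚ)) (hram₁ : Ram W₁ p) :
    RamTwistLowerBoundAt W p W₁ ↔ X2.MazurMainConjectureAt W p := by
  refine ⟨mazurMainConjectureAt_of_ramTwistLowerBound W p hKato hA hpar hp hmult hsurj hd0 hpd W₁ hC₁
    hram₁, fun hMC => ?_⟩
  have hd0' : (d : ℚ) ≠ 0 := by exact_mod_cast hd0
  obtain ⟨C₁, hC₁'⟩ := hC₁
  have hsurj₁ : Surj W₁ p :=
    (Additive.surj_iff_of_model_twist W p hd0' ⟨C₁⁻¹, by rw [← hC₁', inv_smul_smul]⟩).mpr hsurj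
  exact ramTwistLowerBoundAt_of_mazurMainConjectureAt W p hA (by omega) hmult hpd W₁ ⟨C₁, hC₁'⟩
    (irr_of_surj W₁ p hsurj₁) hram₁ hMC

/-- **`BSD(E,p)` on class X11a at `p ≥ 5` with surjective `ρ̄_{E,p}` from the T-BCRAM input.**
Inputs: the typed OPEN input `RamTwistLowerBoundAt W p W₁` for ONE (ram)-carrying twist model `W₁`
(`p ∤ d`); the PUBLISHED named facts Kato–Wuthrich A32 (`hKato`), Skinner 2016 Thm. A (`hA`),
Stein–Wuthrich 2013 Thm. 6.1 split / non-split (`hJs`, `hJn`), Greenberg–Stevens (`hGS`), GZK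
(`hGZK`), modularity once (`hNf`). Glue: `mazurMainConjectureAt_of_ramTwistLowerBound` +
`bsdp_of_mazurMainConjectureAt_heightFree`. By the `iff` above this is the chain of record with its
input renamed; nothing booked; no label change. [cite: Skinner2016PacificMC, Thm. A]
[cite: SteinWuthrich2013, Thm. 6.1 (p. 20)] [cite: Wuthrich2014, Thm. 3 and Cor. 19] -/
theorem bsdp_of_ramTwistLowerBound (hNf : exists_isNewformOf)
    (hKato : kato_charIdeal_dvd_multiplicative_of_surjective) (hA : thmA_charIdeal_multiplicative)
    (hJs : thm61_splitMultiplicative) (hJn : thm61_nonsplitMultiplicative)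
    (hGZK : rank_eq_analyticRank_of_analyticRank_le_one)
    (hGS : greenberg_stevens (W := W) (p := p))
    (hX : ClassX11a W p) (hp : 5 ≤ p) (hsurj : Surj W p)
    {d : ℤ} (hd0 : d ≠ 0) (hpd : ¬ (p : ℤ) ∣ d)
    (W₁ : WeierstrassCurve ℚ) [W₁.IsElliptic] [W₁.IsGloballyMinimal]
    (hC₁ : ∃ C : VariableChange ℚ, C • W₁ = W.quadraticTwist (d : ℚ)) (hram₁ : Ram W₁ p)
    (hBC : RamTwistLowerBoundAt W p W₁) : BSDp W p :=
  bsdp_of_mazurMainConjectureAt_heightFree hJs hJn hGZK (hasEntireLFunction_rat_of_exists_isNewformOf hNf)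
    (nonempty_modularParametrizationData_of_exists_isNewformOf hNf
      IsNewformOf.exists_maninConstant_ne_zero_holds) hGS hX
    (mazurMainConjectureAt_of_ramTwistLowerBound W p hKato hA
      (nonempty_modularParametrizationData_of_exists_isNewformOf hNf
        IsNewformOf.exists_maninConstant_ne_zero_holds) hp hX.mult hsurj hd0 hpd W₁ hC₁ hram₁ hBC)

/-- **The census atom suffices as the datum**: on X11a at `p ≥ 5` with `ρ̄` onto, if SOME twist with
`p ∤ d` carries (ram) (`RamOverQuadraticTwistAt W p`) and the typed input holds for every such twist
model, then `BSD(E,p)`. [cite: Skinner2016PacificMC, Thm. A] -/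
theorem bsdp_of_ramOverQuadraticTwist (hNf : exists_isNewformOf)
    (hKato : kato_charIdeal_dvd_multiplicative_of_surjective) (hA : thmA_charIdeal_multiplicative)
    (hJs : thm61_splitMultiplicative) (hJn : thm61_nonsplitMultiplicative)
    (hGZK : rank_eq_analyticRank_of_analyticRank_le_one)
    (hGS : greenberg_stevens (W := W) (p := p))
    (hX : ClassX11a W p) (hp : 5 ≤ p) (hsurj : Surj W p) (hat : RamOverQuadraticTwistAt W p)
    (hBC : ∀ (W₁ : WeierstrassCurve ℚ) [W₁.IsElliptic] [W₁.IsGloballyMinimal], Ram W₁ p →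
      (∃ (d : ℤ) (C : VariableChange ℚ), ¬ (p : ℤ) ∣ d ∧ C • W₁ = W.quadraticTwist (d : ℚ)) →
      RamTwistLowerBoundAt W p W₁) : BSDp W p := by
  obtain ⟨d, W₁, _, _, hd0, hpd, ⟨C, hC⟩, hram₁⟩ := hat
  exact bsdp_of_ramTwistLowerBound W p hNf hKato hA hJs hJn hGZK hGS hX hp hsurj hd0 hpd W₁ ⟨C, hC⟩ hram₁
    (hBC W₁ hram₁ ⟨d, C, hpd, hC⟩)

end Main

end Summit.BirchSwinnertonDyer.Rank1Residual.X11a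

end
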